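import Literature.MathematicalPhysics.StatisticalMechanics.BarlowStacking
import HarnessLib

/-!
# Fcc positions are ℤ-linear in the chart coordinates

HONEST FRAMING. Part of the venture `Summits/Ventures/Crystal3D` (cell `crystal3d-full`). Coordinate
identities for the model fcc lattice `barlowPos a h constHagg`; nothing about packings.

**Theorems** (step (L3)(a) of the cell's P1-SPEC-A = `LatticeNoGain` at a general normal,
HOME/eng/MEMO-3.md ADDENDUM K).  With `u = barlowPos a h constHagg 0 1 0`, `v = barlowPos … 0 0 1`,
`t = barlowPos … 1 0 0` (the in-layer basis and the up-bond of the model fcc lattice):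
* `barlowPos_fcc_linear`: `barlowPos a h constHagg k i j = i•u + j•v + k•t`;
* `barlowPos_fcc_chart₁`: in the coordinates `ψ₁ = (c₀, c₁, c₂) = (i, j + k, −k)` of
  `FccLoomisWhitney.lean` the position is `c₀•u + c₁•v + c₂•(v − t)`;
* `barlowPos_fcc_chart₂`: in `ψ₂ = (k + i + j, i + j, −j)` it is `c₀•t + c₁•(u − t) + c₂•(u − v)`.
So the bond line of chart `m`, direction `d`, index `(a, b) = π_d c` is `P₀(a,b) + ℤ•W` with
`W ∈ {u, v, v − t}` (`m = 1`) or `{t, u − t, u − v}` (`m = 2`) and `P₀` linear in `(a, b)` — the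
parametrization fed to `SlabTransversal.lean` / `PlaneCoordinates.lean` / `AffineDiscCount.lean`.

WHAT THIS IS NOT: anything asymptotic; rung F-C1 not moved.
-/

noncomputable section

namespace Summit.Ventures.Crystal3D

open Literature.MathematicalPhysics.StatisticalMechanics (barlowPos constHagg haggLabel_const
  barlowPos_apply_zero barlowPos_apply_one barlowPos_apply_two)

/-- **Fcc positions are ℤ-linear**: `barlowPos a h constHagg k i j = i•u + j•v + k•t` with
`u, v, t` the images of `(0,1,0), (0,0,1), (1,0,0)`. -/
theorem barlowPos_fcc_linear (a h : ℝ) (k i j : ℤ) :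
    barlowPos a h constHagg k i j =
      (i : ℝ) • barlowPos a h constHagg 0 1 0 + (j : ℝ) • barlowPos a h constHagg 0 0 1 +
        (k : ℝ) • barlowPos a h constHagg 1 0 0 := by
  ext l
  fin_cases l <;>
    simp [barlowPos_apply_zero, barlowPos_apply_one, barlowPos_apply_two, haggLabel_const] <;> ring

/-- **Chart 1.** With `ψ₁(k,i,j) = (i, j + k, −k)`: the position is `c₀•u + c₁•v + c₂•(v − t)`,
i.e. `barlowPos a h constHagg k i j = i•u + (j + k)•v + (−k)•(v − t)`. -/
theorem barlowPos_fcc_chart₁ (a h : ℝ) (k i j : ℤ) :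
    barlowPos a h constHagg k i j =
      (i : ℝ) • barlowPos a h constHagg 0 1 0 + ((j + k : ℤ) : ℝ) • barlowPos a h constHagg 0 0 1 +
        ((-k : ℤ) : ℝ) • (barlowPos a h constHagg 0 0 1 - barlowPos a h constHagg 1 0 0) := by
  ext l
  fin_cases l <;>
    simp [barlowPos_apply_zero, barlowPos_apply_one, barlowPos_apply_two, haggLabel_const] <;> ring

/-- **Chart 2.** With `ψ₂(k,i,j) = (k + i + j, i + j, −j)`: the position is
`c₀•t + c₁•(u − t) + c₂•(u − v)`. -/
theorem barlowPos_fcc_chart₂ (a h : ℝ) (k i j : ℤ) :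
    barlowPos a h constHagg k i j =
      ((k + i + j : ℤ) : ℝ) • barlowPos a h constHagg 1 0 0 +
        ((i + j : ℤ) : ℝ) • (barlowPos a h constHagg 0 1 0 - barlowPos a h constHagg 1 0 0) +
        ((-j : ℤ) : ℝ) • (barlowPos a h constHagg 0 1 0 - barlowPos a h constHagg 0 0 1) := by
  ext l
  fin_cases l <;>
    simp [barlowPos_apply_zero, barlowPos_apply_one, barlowPos_apply_two, haggLabel_const] <;> ring

end Summit.Ventures.Crystal3D

end
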